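import Summits.FinalStateConjecture.FinalStateConjecture.Statement
import Literature.Geometry.Lorentzian.TameBreathingCurve
import Literature.Geometry.Lorentzian.CauchyDevelopmentPrecomp
import Literature.Geometry.Lorentzian.AFEndUnbreathe
import HarnessLib

/-!
# `CaptureSufficesC2` (stmt-FinalStateConjecture-14986), line `censorship-enters-diagonally`, v4:
# the two SELF-WITNESS stubs — through every quiet (resp. margin) admissible datum passes a tame,
# injective, immersed curve of quiet (resp. margin) admissible data

Registered stubs `stub_quietSelfWitness`, `stub_marginSelfWitness` of the skeleton
`Cruxes/CaptureSufficesC2/Lines/censorship_enters_diagonally.lean` (v4). Both are discharged by the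
BREATHING CURVE of the datum `d` (`Literature/Geometry/Lorentzian/TameBreathingCurve.lean`): pull-backs
`E_c = (breathe (σ c₀))^* d` of `d` along compactly supported diffeomorphisms, a tame (on a collared
restriction of the sole end of `d`), injective, immersed curve of admissible data through `d`
(`isTameDataFamily_restrict_breatheCurve`, `injective_breatheCurve`, `isImmersedAtZero_breatheCurve`,
`breatheCurve_mem_admissibleVacuumData`), along which the development-level clauses transfer because
isometric data have "the same" maximal developments (`Literature/Geometry/Lorentzian/CauchyDevelopmentPrecomp.lean`:
`censored_comap_iff`, `quietTracking_comap_iff`, `marginTracking_comap_iff`, via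
`VacuumCauchyDevelopment.precomp` and `isMaximal_precomp_iff`).

* `injective_mfderiv_homeomorph_symm` — the differentials of the inverse of a homeomorphism that is
  smooth both ways are injective (chain rule against `Φ ∘ Φ⁻¹ = id`);
* `quiet_breatheFamily`, `margin_breatheFamily` — QUIET / MARGIN pass from `d` to every member of its
  breathing family;
* `stub_quietSelfWitness`, `stub_marginSelfWitness` — the registered stubs.
-/

-- the doubled `FinalStateConjecture.FinalStateConjecture` path component trips dupNamespace
set_option linter.dupNamespace false

noncomputable section

open Set Function Filter
open scoped Manifold ContDiff Topology

namespace Summit.FinalStateConjecture.FinalStateConjecture.Theorems.PhaseMixingCaptureCaptureSufficesC2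

open Literature.Geometry.Lorentzian

section Helpers

variable {X : Type} [TopologicalSpace X] [ChartedSpace E3 X] [IsManifold (𝓡 3) ∞ X]

omit [IsManifold (𝓡 3) ∞ X] in
/-- **The differentials of the inverse of a both-ways-smooth homeomorphism are injective**: from
`Φ ∘ Φ⁻¹ = id`, `dΦ ∘ dΦ⁻¹ = id` (chain rule and uniqueness of the derivative). [folklore] -/
theorem injective_mfderiv_homeomorph_symm (Φ : X ≃ₜ X)
    (hΦ : ContMDiff (𝓡 3) (𝓡 3) (∞ + 1) Φ) (hΨ : ContMDiff (𝓡 3) (𝓡 3) (∞ + 1) Φ.symm) (u : X) :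
    Injective (mfderiv (𝓡 3) (𝓡 3) Φ.symm u) := by
  have hd1 : MDifferentiableAt (𝓡 3) (𝓡 3) Φ (Φ.symm u) :=
    (hΦ.of_le le_self_add).mdifferentiableAt (by simp)
  have hd2 : MDifferentiableAt (𝓡 3) (𝓡 3) Φ.symm u :=
    (hΨ.of_le le_self_add).mdifferentiableAt (by simp)
  have hcomp : HasMFDerivAt (𝓡 3) (𝓡 3) (⇑Φ ∘ ⇑Φ.symm) u
      ((mfderiv (𝓡 3) (𝓡 3) Φ (Φ.symm u)).comp (mfderiv (𝓡 3) (𝓡 3) Φ.symm u)) :=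
    hd1.hasMFDerivAt.comp u hd2.hasMFDerivAt
  have hid : HasMFDerivAt (𝓡 3) (𝓡 3) (⇑Φ ∘ ⇑Φ.symm) u
      (ContinuousLinearMap.id ℝ (TangentSpace (𝓡 3) u)) := by
    have h := hasMFDerivAt_id (I := 𝓡 3) u
    exact h.congr_of_eventuallyEq (Eventually.of_forall fun x ↦ Φ.apply_symm_apply x)
  have heq : (mfderiv (𝓡 3) (𝓡 3) Φ (Φ.symm u)).comp (mfderiv (𝓡 3) (𝓡 3) Φ.symm u) =
      ContinuousLinearMap.id ℝ (TangentSpace (𝓡 3) u) :=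
    hcomp.mfderiv.symm.trans hid.mfderiv
  intro v w hvw
  have h := congrArg (mfderiv (𝓡 3) (𝓡 3) Φ (Φ.symm u)) hvw
  rw [← ContinuousLinearMap.comp_apply, ← ContinuousLinearMap.comp_apply, heq] at h
  exact h

variable [T2Space X] [ConnectedSpace X]
  {e : AFEnd X} {z₀ : E3} {r : ℝ} (B : AFEnd.BreathingData e z₀ r) (d : InitialDataSet (𝓡 3) X)

/-- **QUIET passes from `d` to every member of its breathing family**: censored (an MGHD exists, every
MGHD has complete `𝓘⁺`) and adiabatically tracked at every accuracy in every MGHD, transferred along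
`E_t = (breathe (σ t))^* d` by `censored_comap_iff` / `quietTracking_comap_iff`. [folklore] -/
theorem quiet_breatheFamily (t : ℝ)
    (hQ : ((∃ 𝒟 : VacuumCauchyDevelopment d, 𝒟.IsMaximal) ∧
        ∀ 𝒟 : VacuumCauchyDevelopment d, 𝒟.IsMaximal →
          Summit.FinalStateConjecture.HasCompleteNullInfinity 𝒟.toCauchyDevelopment) ∧
      ∀ 𝒟 : VacuumCauchyDevelopment d, 𝒟.IsMaximal →
        ∀ (L : ℝ) (ε : ENNReal) (R₀ : ℝ), 0 < L → 0 < ε →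
          ∃ (N : ℕ) (m₀ χ : ℝ), 0 < m₀ ∧ 0 ≤ χ ∧ χ < 1 ∧ 𝒟.IsAdiabaticallyTracked N m₀ χ ε L R₀) :
    ((∃ 𝒟 : VacuumCauchyDevelopment (AFEnd.breatheFamily B d t), 𝒟.IsMaximal) ∧
        ∀ 𝒟 : VacuumCauchyDevelopment (AFEnd.breatheFamily B d t), 𝒟.IsMaximal →
          Summit.FinalStateConjecture.HasCompleteNullInfinity 𝒟.toCauchyDevelopment) ∧
      ∀ 𝒟 : VacuumCauchyDevelopment (AFEnd.breatheFamily B d t), 𝒟.IsMaximal →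
        ∀ (L : ℝ) (ε : ENNReal) (R₀ : ℝ), 0 < L → 0 < ε →
          ∃ (N : ℕ) (m₀ χ : ℝ), 0 < m₀ ∧ 0 ≤ χ ∧ χ < 1 ∧ 𝒟.IsAdiabaticallyTracked N m₀ χ ε L R₀ := by
  set Φ : X ≃ₜ X := AFEnd.breatheHomeomorph B (AFEnd.abs_squash_lt_invScale B t) with hΦdef
  have hΦ : ContMDiff (𝓡 3) (𝓡 3) (∞ + 1) Φ :=
    AFEnd.contMDiff_breathe_succ B (AFEnd.abs_squash_lt_scale B t).2
  have hΦ' : ∀ u, Injective (mfderiv (𝓡 3) (𝓡 3) Φ u) :=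
    (AFEnd.breatheScale_spec B).2.2 _ (AFEnd.abs_squash_lt_scale B t).1
  have hΨ : ContMDiff (𝓡 3) (𝓡 3) (∞ + 1) Φ.symm := AFEnd.contMDiff_unbreathe B _
  have hΨ' : ∀ u, Injective (mfderiv (𝓡 3) (𝓡 3) Φ.symm u) :=
    injective_mfderiv_homeomorph_symm Φ hΦ hΨ
  have key : AFEnd.breatheFamily B d t = d.comap Φ hΦ hΦ' := rfl
  rw [key]
  exact ⟨(VacuumCauchyDevelopment.censored_comap_iff Φ hΦ hΦ' hΨ hΨ').2 hQ.1,
    (VacuumCauchyDevelopment.quietTracking_comap_iff Φ hΦ hΦ' hΨ hΨ').2 hQ.2⟩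

/-- **MARGIN passes from `d` to every member of its breathing family** (`censored_comap_iff`,
`marginTracking_comap_iff`). [folklore] -/
theorem margin_breatheFamily (t : ℝ)
    (hM : ((∃ 𝒟 : VacuumCauchyDevelopment d, 𝒟.IsMaximal) ∧
        ∀ 𝒟 : VacuumCauchyDevelopment d, 𝒟.IsMaximal →
          Summit.FinalStateConjecture.HasCompleteNullInfinity 𝒟.toCauchyDevelopment) ∧
      ∀ 𝒟 : VacuumCauchyDevelopment d, 𝒟.IsMaximal →
        ∃ (N : ℕ) (m₀ χ : ℝ), 0 < m₀ ∧ 0 ≤ χ ∧ χ < 1 ∧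
          ∀ (L : ℝ) (ε : ENNReal) (R₀ : ℝ), 0 < L → 0 < ε → 𝒟.IsAdiabaticallyTracked N m₀ χ ε L R₀) :
    ((∃ 𝒟 : VacuumCauchyDevelopment (AFEnd.breatheFamily B d t), 𝒟.IsMaximal) ∧
        ∀ 𝒟 : VacuumCauchyDevelopment (AFEnd.breatheFamily B d t), 𝒟.IsMaximal →
          Summit.FinalStateConjecture.HasCompleteNullInfinity 𝒟.toCauchyDevelopment) ∧
      ∀ 𝒟 : VacuumCauchyDevelopment (AFEnd.breatheFamily B d t), 𝒟.IsMaximal →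
        ∃ (N : ℕ) (m₀ χ : ℝ), 0 < m₀ ∧ 0 ≤ χ ∧ χ < 1 ∧
          ∀ (L : ℝ) (ε : ENNReal) (R₀ : ℝ), 0 < L → 0 < ε → 𝒟.IsAdiabaticallyTracked N m₀ χ ε L R₀ := by
  set Φ : X ≃ₜ X := AFEnd.breatheHomeomorph B (AFEnd.abs_squash_lt_invScale B t) with hΦdef
  have hΦ : ContMDiff (𝓡 3) (𝓡 3) (∞ + 1) Φ :=
    AFEnd.contMDiff_breathe_succ B (AFEnd.abs_squash_lt_scale B t).2
  have hΦ' : ∀ u, Injective (mfderiv (𝓡 3) (𝓡 3) Φ u) :=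
    (AFEnd.breatheScale_spec B).2.2 _ (AFEnd.abs_squash_lt_scale B t).1
  have hΨ : ContMDiff (𝓡 3) (𝓡 3) (∞ + 1) Φ.symm := AFEnd.contMDiff_unbreathe B _
  have hΨ' : ∀ u, Injective (mfderiv (𝓡 3) (𝓡 3) Φ.symm u) :=
    injective_mfderiv_homeomorph_symm Φ hΦ hΨ
  have key : AFEnd.breatheFamily B d t = d.comap Φ hΦ hΦ' := rfl
  rw [key]
  exact ⟨(VacuumCauchyDevelopment.censored_comap_iff Φ hΦ hΦ' hΨ hΨ').2 hM.1,
    (VacuumCauchyDevelopment.marginTracking_comap_iff Φ hΦ hΦ' hΨ hΨ').2 hM.2⟩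

end Helpers

/-! ### The registered stubs -/

open scoped ENNReal


/-- **Stub 2b `stub_quietSelfWitness` — through every QUIET admissible datum passes a tame injective
immersed admissible curve of QUIET data.** Witness: the breathing curve of `d` on a coordinate ball
far out on the sole end of `d`, read on a collared restriction of that end
(`Literature/Geometry/Lorentzian/TameBreathingCurve.lean`); QUIET transfers along it
(`quiet_breatheFamily`). The handed-over end `e` and the tameness of the constant curve are not used.
[cite: Christodoulou1999, p. A24] -/
theorem stub_quietSelfWitness :
    ∀ (X : Type) [TopologicalSpace X] [ChartedSpace E3 X] [IsManifold (𝓡 3) ∞ X] [T2Space X]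
      [SecondCountableTopology X] [ConnectedSpace X] (e : AFEnd X) (d : InitialDataSet (𝓡 3) X),
      InitialDataSet.IsTameDataFamily e 1 (fun _ : EuclideanSpace ℝ (Fin 1) ↦ d) →
        d ∈ admissibleVacuumData X →
          (((∃ 𝒟 : VacuumCauchyDevelopment (d), 𝒟.IsMaximal) ∧
             ∀ 𝒟 : VacuumCauchyDevelopment (d), 𝒟.IsMaximal →
               Summit.FinalStateConjecture.HasCompleteNullInfinity 𝒟.toCauchyDevelopment) ∧
            ∀ 𝒟 : VacuumCauchyDevelopment (d), 𝒟.IsMaximal →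
              ∀ (L : ℝ) (ε : ℝ≥0∞) (R₀ : ℝ), 0 < L → 0 < ε →
                ∃ (N : ℕ) (m₀ χ : ℝ), 0 < m₀ ∧ 0 ≤ χ ∧ χ < 1 ∧
                  𝒟.IsAdiabaticallyTracked N m₀ χ ε L R₀) →
          ∃ (e' : AFEnd X) (F' : EuclideanSpace ℝ (Fin 1) → InitialDataSet (𝓡 3) X),
            InitialDataSet.IsTameDataFamily e' 1 F' ∧ F' 0 = d ∧ Function.Injective F' ∧
              InitialDataSet.IsImmersedAtZero 1 F' ∧ (∀ c, F' c ∈ admissibleVacuumData X) ∧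
              ∀ c : EuclideanSpace ℝ (Fin 1), c ≠ 0 →
                (((∃ 𝒟 : VacuumCauchyDevelopment (F' c), 𝒟.IsMaximal) ∧
                   ∀ 𝒟 : VacuumCauchyDevelopment (F' c), 𝒟.IsMaximal →
                     Summit.FinalStateConjecture.HasCompleteNullInfinity 𝒟.toCauchyDevelopment) ∧
                  ∀ 𝒟 : VacuumCauchyDevelopment (F' c), 𝒟.IsMaximal →
                    ∀ (L : ℝ) (ε : ℝ≥0∞) (R₀ : ℝ), 0 < L → 0 < ε →
                      ∃ (N : ℕ) (m₀ χ : ℝ), 0 < m₀ ∧ 0 ≤ χ ∧ χ < 1 ∧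
                        𝒟.IsAdiabaticallyTracked N m₀ χ ε L R₀) := by
  intro X _ _ _ _ _ _ e d _ hd hQ
  obtain ⟨-, e₀, M, hsole, hdecay⟩ := id hd
  -- a breathing ball far out on the sole end of `d`
  set z₀ : E3 := (e₀.R + 3) • EuclideanSpace.single (0 : Fin 3) (1 : ℝ) with hz₀
  have hz₀n : ‖z₀‖ = e₀.R + 3 := by
    rw [hz₀, norm_smul, PiLp.norm_single, norm_one, mul_one,
      Real.norm_of_nonneg (by linarith [e₀.R_pos])]
  have B : e₀.BreathingData z₀ 1 := ⟨one_pos, by rw [hz₀n]; linarith⟩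
  have hR₁ : e₀.R < e₀.R + 1 := by linarith
  exact ⟨e₀.restrict hR₁.le, fun c ↦ AFEnd.breatheFamily B d (c 0),
    AFEnd.isTameDataFamily_restrict_breatheCurve B d hsole hdecay hR₁,
    AFEnd.breatheCurve_zero B d, AFEnd.injective_breatheCurve B d,
    AFEnd.isImmersedAtZero_breatheCurve B d,
    fun c ↦ AFEnd.breatheCurve_mem_admissibleVacuumData B d hd c,
    fun c _ ↦ quiet_breatheFamily B d (c 0) hQ⟩

/-- **Stub 3b `stub_marginSelfWitness` — through every MARGIN admissible datum passes a tame injective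
immersed admissible curve of MARGIN data** (breathing curve; `margin_breatheFamily`).
[cite: Christodoulou1999, p. A24] -/
theorem stub_marginSelfWitness :
    ∀ (X : Type) [TopologicalSpace X] [ChartedSpace E3 X] [IsManifold (𝓡 3) ∞ X] [T2Space X]
      [SecondCountableTopology X] [ConnectedSpace X] (e : AFEnd X) (d : InitialDataSet (𝓡 3) X),
      InitialDataSet.IsTameDataFamily e 1 (fun _ : EuclideanSpace ℝ (Fin 1) ↦ d) →
        d ∈ admissibleVacuumData X →
          (((∃ 𝒟 : VacuumCauchyDevelopment (d), 𝒟.IsMaximal) ∧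
             ∀ 𝒟 : VacuumCauchyDevelopment (d), 𝒟.IsMaximal →
               Summit.FinalStateConjecture.HasCompleteNullInfinity 𝒟.toCauchyDevelopment) ∧
            ∀ 𝒟 : VacuumCauchyDevelopment (d), 𝒟.IsMaximal →
              ∃ (N : ℕ) (m₀ χ : ℝ), 0 < m₀ ∧ 0 ≤ χ ∧ χ < 1 ∧
                ∀ (L : ℝ) (ε : ℝ≥0∞) (R₀ : ℝ), 0 < L → 0 < ε →
                  𝒟.IsAdiabaticallyTracked N m₀ χ ε L R₀) →
          ∃ (e' : AFEnd X) (F' : EuclideanSpace ℝ (Fin 1) → InitialDataSet (𝓡 3) X),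
            InitialDataSet.IsTameDataFamily e' 1 F' ∧ F' 0 = d ∧ Function.Injective F' ∧
              InitialDataSet.IsImmersedAtZero 1 F' ∧ (∀ c, F' c ∈ admissibleVacuumData X) ∧
              ∀ c : EuclideanSpace ℝ (Fin 1), c ≠ 0 →
                (((∃ 𝒟 : VacuumCauchyDevelopment (F' c), 𝒟.IsMaximal) ∧
                   ∀ 𝒟 : VacuumCauchyDevelopment (F' c), 𝒟.IsMaximal →
                     Summit.FinalStateConjecture.HasCompleteNullInfinity 𝒟.toCauchyDevelopment) ∧
                  ∀ 𝒟 : VacuumCauchyDevelopment (F' c), 𝒟.IsMaximal →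
                    ∃ (N : ℕ) (m₀ χ : ℝ), 0 < m₀ ∧ 0 ≤ χ ∧ χ < 1 ∧
                      ∀ (L : ℝ) (ε : ℝ≥0∞) (R₀ : ℝ), 0 < L → 0 < ε →
                        𝒟.IsAdiabaticallyTracked N m₀ χ ε L R₀) := by
  intro X _ _ _ _ _ _ e d _ hd hM
  obtain ⟨-, e₀, M, hsole, hdecay⟩ := id hd
  set z₀ : E3 := (e₀.R + 3) • EuclideanSpace.single (0 : Fin 3) (1 : ℝ) with hz₀
  have hz₀n : ‖z₀‖ = e₀.R + 3 := by
    rw [hz₀, norm_smul, PiLp.norm_single, norm_one, mul_one,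
      Real.norm_of_nonneg (by linarith [e₀.R_pos])]
  have B : e₀.BreathingData z₀ 1 := ⟨one_pos, by rw [hz₀n]; linarith⟩
  have hR₁ : e₀.R < e₀.R + 1 := by linarith
  exact ⟨e₀.restrict hR₁.le, fun c ↦ AFEnd.breatheFamily B d (c 0),
    AFEnd.isTameDataFamily_restrict_breatheCurve B d hsole hdecay hR₁,
    AFEnd.breatheCurve_zero B d, AFEnd.injective_breatheCurve B d,
    AFEnd.isImmersedAtZero_breatheCurve B d,
    fun c ↦ AFEnd.breatheCurve_mem_admissibleVacuumData B d hd c,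
    fun c _ ↦ margin_breatheFamily B d (c 0) hM⟩

end Summit.FinalStateConjecture.FinalStateConjecture.Theorems.PhaseMixingCaptureCaptureSufficesC2

end
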